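import Summits.QuantumFields.YangMills.Theorems.BalabanUVNodesN11AFibreDominationRow
import Literature.MathematicalPhysics.QuantumFieldTheory.Balaban1983to89.B15Prop1DatumSmall7AtZSequence

/-!
# DAG node N11 — THE COVERING BEHIND THE A-FIBRE DOMINATION ROW HOLDS AT EVERY REGION THAT IS A UNION OF χ_{j+1}-CUBES: a level-`j` bond of such a region
# lies in the `∼2`-star of the χ_{j+1}-cube containing its source (one `T^{(j)}`-step is `L^j ≤ L^{j+2}M₂R_{j+1}` fine sites); hence at the certificate `rePinH θ`
# the row for the all-small branch value holds at every history whose region `Λ_{j+1}ᶜ ∩ Ω_{j+1}` is χ_{j+1}-saturated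

HEADER — WORK-UNIT METADATA.  Cell `pub-ymgap`, YM-PLAN Track A (D-0062 ∕ D-0149 width seats), seat `pub-ymgap-dag-n11-w1` (g0; WIDTH SEAT 1 of 4 on NODE n11 [B14]),
route `BalabanUVNodes` rev 25, item K1⁷ `StabilityBAtRecordR13SepCoPH` = stmt-QuantumFields-20542 (helper, `--kind proof --supports 20542 --as helper`, count-neutral).
[III] = [Balaban1988Convergent], [I] = [Balaban1987RG1].  Sequel of this seat's `…N11AFibreDominationRow` (★★ `afibre_dominated_rePinH_of_cover`: row ⟸ COVERING; ★★★
`afibre_dominated_rePinH_iff_cover`), over 12a `Node00.TkWeightsOfRecord` (`bondsStarW`, `cubeχ`, `sideχ`), def-R's cube geometry (`cubeEnl`, `cubeIndices`,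
`unionsOfCubes`), and the torus arithmetic `B15Prop1DatumSmall7AtZSequence.cover_add_single_pow` (`ι_j(c + e_μ)` is covered by `x + L^j e_μ`).

WHY THIS FILE.  The covering «every level-`j` bond of `Y` lies in `(□′^{∼2})^{(j)*}` for some χ_{j+1}-cube `□′ ⊂ Y`» is displayed in `…N11AFibreDominationRow`; it
fails at thin regions (their §3) and — THIS FILE — it HOLDS at every `Y` that is a union of χ_{j+1}-cubes (`Y ∈ unionsOfCubes (sideχ j)` = 11a's S-class
`SClassOfRecord … (j+1)`, the class print's `R_{j+1}`, `P_{j+1}`, `Q_{j+1}`, `S_{j+1}` range over): the source of the bond lies in a cube `□′ ⊂ Y` of the union, and its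
target `ι_j(b₋ + e_μ) = π(x + L^j e_μ)` lies in the `2·side` collar of the same cube because `L^j ≤ 2·L^{j+2}M₂R_{j+1}` (`1 ≤ M₂`, `1 ≤ R_{j+1}`).

WHAT THIS FILE PROVES (0 `sorry`, 0 `def`; nothing of Bałaban asserted).  §1 `pow_le_two_mul_sideχ` (`L^j ≤ 2·sideχ`), ★ `mem_bondsStarW_of_mem_cubeχ` (a bond whose
source lies in `□′` is a star bond of `□′`), ★★ `cover_of_mem_unionsOfCubes` (THE COVERING at every χ_{j+1}-saturated region).  §2 ★★ `afibre_dominated_rePinH_of_saturated`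
(at `rePinH θ`, `S_{j+1} = ∅`: the A-fibre domination row of generation `j` at every history whose region `Λ_{j+1}(init s′)ᶜ ∩ Ω_{j+1}(init s′)` is a union of
χ_{j+1}-cubes) and its generic-`θ` form under [I]'s sign `0 ≤ quad` (`afibre_dominated_of_saturated_of_quad_nonneg`).  §3 ★★
`exists_local_witness_clause_succ_rePinH_of_sLaw₁₃CoPH_of_noLargeField`: dag-n11-d's witness-first ★★★ with its (K0b) rows DISCHARGED on the whole no-large-field
sub-diagonal (`…AFibreDominationRow.rows_rePinH_of_noLargeField`): there the 𝐓-image clause at the certificate needs def-T's operand rows ONLY.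

HONEST FRAMING.  Helper lane of K1⁷; kernel bookkeeping; nothing of Bałaban's estimates asserted; no law of record edited or posited.  N11 NOT discharged; K1⁷ NOT closed;
counts unmoved (typed 28∕28 · discharged 5∕27).  R4 closes only the conditional finite-𝕋⁴ rung `BalabanLadder.UV` of one programme at fixed `ε = L^{−K}` — NOT ℝ⁴,
NOT OS, NOT a mass gap, NOT Clay.  No `sorry`, `axiom`, `instance`, `notation`.
Sources (SHAPE only): [III] (2.1) p.254, (2.21) p.258, (3.2)–(3.4) p.265, (3.16) p.268, (3.21) p.269; [I] (0.1) p.251.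
-/

noncomputable section

open MeasureTheory
open scoped BigOperators ENNReal NNReal Matrix.Norms.L2Operator

namespace Summit.QuantumFields.YangMills.Theorems.BalabanUVNodesN11AFibreDominationRowCubeCover

open Literature.MathematicalPhysics.QuantumFieldTheory.Balaban1983to89 T4Continuum Node00 Node00.Tk
open B14.Eq218Concrete (cubesIn mem_cubesIn)
open B10Eq42TorusConstraint (bondsIn mem_bondsIn_iff)
open B14.Eq213MaximalDomains (cubeExt)
open B15Eq112TorusCover (cover)
open B15DeterminingSets (embIter)
open BalabanUVNodesN11RePinnedParamDefs
open BalabanUVNodesN11AFibreDominationRow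

variable {F : T4Family} {N : ℕ} [NeZero N]

/-! ## §1  A bond whose source lies in a χ_{j+1}-cube is a star bond of that cube; the covering at χ-saturated regions -/

section Geometry

variable (ν : Stage7Numerics) (p : B12.RunParams) (g : ℕ → ℝ) (j : ℕ)

/-- `L^j ≤ 2·(side of the χ_{j+1}-cubes) = 2·L^{j+2}M₂R_{j+1}` for `1 ≤ L`, `1 ≤ M₂` (`1 ≤ R_{j+1}` always). [cite: Balaban1988Convergent, (3.2) p.265, (2.5) p.255 (bookkeeping)] -/
theorem pow_le_two_mul_sideχ (hL : 1 ≤ (F.P p.K).L) (hM₂ : 1 ≤ ν.M₂) : (F.P p.K).L ^ j ≤ 2 * sideχ F ν p g j := by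
  have hR : 1 ≤ RkOfRecord (F.P p.K).L ν.r (g (j + 1)) := B14SeparationOfRecord.one_le_RkOfRecord hL _ _
  unfold sideχ cubeSide
  have h1 : (F.P p.K).L ^ j ≤ (F.P p.K).L ^ (j + 1 + 1) := Nat.pow_le_pow_right hL (by omega)
  calc (F.P p.K).L ^ j ≤ (F.P p.K).L ^ (j + 1 + 1) * 1 * 1 := by rw [mul_one, mul_one]; exact h1
    _ ≤ (F.P p.K).L ^ (j + 1 + 1) * ν.M₂ * RkOfRecord (F.P p.K).L ν.r (g (j + 1)) := by gcongr
    _ ≤ 2 * ((F.P p.K).L ^ (j + 1 + 1) * ν.M₂ * RkOfRecord (F.P p.K).L ν.r (g (j + 1))) := Nat.le_mul_of_pos_left _ two_pos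

/-- **★ A LEVEL-`j` BOND WHOSE SOURCE LIES IN THE χ_{j+1}-CUBE `□′` IS A STAR BOND OF `□′`** (`b ∈ (□′^{∼2})^{(j)*}`): the source lies in `□′ ⊂ □′^{∼2}`, and the
target `ι_j(b₋ + e_μ) = π(x + L^j e_μ)` (`B15Prop1DatumSmall7AtZSequence.cover_add_single_pow`) lies in the `2·side` collar since `L^j ≤ 2·side`.
[cite: Balaban1988Convergent, (3.16) p.268, (3.3) p.265; Balaban1987RG1, (0.1) p.251] -/
theorem mem_bondsStarW_of_mem_cubeχ (hL : 1 ≤ (F.P p.K).L) (hM₂ : 1 ≤ ν.M₂) (c : Iχ F ν p g j) {b : PBond (F.P p.K) j}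
    (hb : embIter j b.src ∈ cubeχ F ν p g j c) : b ∈ bondsStarW F ν p g j c := by
  classical
  unfold bondsStarW
  rw [Finset.mem_filter]
  refine ⟨Finset.mem_univ _, cubeEnl_mono (F.P p.K) _ _ (Nat.zero_le 2) hb, ?_⟩
  -- the target: a non-wrapping representative one `T^{(j)}`-step away from a representative of the source
  obtain ⟨x, hx, hxc⟩ := hb
  have htgt : cover (F.P p.K) (x + Pi.single b.dir (((F.P p.K).L ^ j : ℕ) : ℤ)) = embIter j b.tgt :=
    B15Prop1DatumSmall7AtZSequence.cover_add_single_pow j hxc b.dir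
  refine ⟨x + Pi.single b.dir (((F.P p.K).L ^ j : ℕ) : ℤ), fun i => ?_, htgt⟩
  have hpow : (((F.P p.K).L : ℤ) ^ j) ≤ 2 * (sideχ F ν p g j : ℤ) := by exact_mod_cast pow_le_two_mul_sideχ ν p g j hL hM₂
  have hpow0 : (0 : ℤ) ≤ ((F.P p.K).L : ℤ) ^ j := by positivity
  have hs0 : (0 : ℤ) ≤ (sideχ F ν p g j : ℤ) := by positivity
  obtain ⟨h1, h2⟩ := hx i
  simp only [Nat.cast_zero, zero_mul, sub_zero, add_zero] at h1 h2
  simp only [Pi.add_apply]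
  push_cast
  by_cases hi : i = b.dir
  · subst hi
    rw [Pi.single_eq_same]
    constructor <;> linarith
  · rw [Pi.single_eq_of_ne hi, add_zero]
    constructor <;> linarith

/-- **★★ THE COVERING HOLDS AT EVERY χ_{j+1}-SATURATED REGION**: if `Y` is a union of χ_{j+1}-cubes (`Y ∈ unionsOfCubes (sideχ j)` — 11a's S-class at `j+1`), every
level-`j` bond of `Y` lies in the `∼2`-star of a χ_{j+1}-cube contained in `Y` (the cube of the union containing its source).
[cite: Balaban1988Convergent, (2.1) p.254, (3.16) p.268, (3.21) p.269] -/
theorem cover_of_mem_unionsOfCubes (hL : 1 ≤ (F.P p.K).L) (hM₂ : 1 ≤ ν.M₂) {Y : Set (Site (F.P p.K) 0)}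
    (hY : Y ∈ unionsOfCubes (F.P p.K) (sideχ F ν p g j)) :
    ∀ b ∈ bondsIn j Y, ∃ c ∈ cubesIn (cubeχ F ν p g j) Y, b ∈ bondsStarW F ν p g j c := by
  obtain ⟨A, hA, rfl⟩ := hY
  intro b hb
  have hsrc : embIter j b.src ∈ ⋃ a ∈ A, cubeEnl (F.P p.K) (sideχ F ν p g j) a 0 := by
    rw [← B10Eq71TorusOverlap.toFine_eq_embIter]; exact hb.1
  rw [Set.mem_iUnion₂] at hsrc
  obtain ⟨a, haA, ha⟩ := hsrc
  refine ⟨⟨a, hA haA⟩, ?_, mem_bondsStarW_of_mem_cubeχ ν p g j hL hM₂ ⟨a, hA haA⟩ ha⟩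
  rw [mem_cubesIn]
  exact Set.subset_biUnion_of_mem (u := fun a' => cubeEnl (F.P p.K) (sideχ F ν p g j) a' 0) haA

/-- The S-class of record at `j+1` IS the class of χ_{j+1}-saturated regions (`rfl`): every admissible branch value `S_{j+1}` is χ_{j+1}-saturated, and so is
every region `Y` of that class. [cite: Balaban1988Convergent, (2.1) p.254, (3.2) p.265 (bookkeeping)] -/
theorem sClassOfRecord_succ_eq : SClassOfRecord F ν g p.K (j + 1) = unionsOfCubes (F.P p.K) (sideχ F ν p g j) := rfl

end Geometry

/-! ## §2  ★★ Hence the row at the certificate for the all-small branch value at every χ-saturated region -/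

section Row

variable (θ : Stage13HParams F N) (p : B12.RunParams)

/-- **★★ THE ROW FOR THE ALL-SMALL BRANCH VALUE, generic `θ` under [I]'s sign `0 ≤ quad`, AT EVERY χ_{j+1}-SATURATED REGION**: if
`Λ_{j+1}(init s′)ᶜ ∩ Ω_{j+1}(init s′)` is a union of χ_{j+1}-cubes, the covering of `…N11AFibreDominationRow.afibre_dominated_of_cover_of_quad_nonneg` holds (§1).
[cite: Balaban1988Convergent, (2.21) p.258, (3.16) p.268, (3.21) p.269, (2.1) p.254] -/
theorem afibre_dominated_of_saturated_of_quad_nonneg (hL : 1 ≤ (F.P p.K).L) (hM₂ : 1 ≤ θ.ν.M₂) {k : ℕ}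
    (s : SeqOfRecord F θ.ν θ.τ9.M (gOfRecord₁₃ F N θ.toStage13Params p) p.K (k + 1)) (j : ℕ)
    (hq : ∀ ω : MultiCfg (F.P p.K) (SU N) (FluctV N), 0 ≤ (θ.zhAt p s).quad j (s.init.Λ (j + 1)) ω)
    (hsat : (s.init.Λ (j + 1))ᶜ ∩ s.init.Ω (j + 1) ∈ unionsOfCubes (F.P p.K) (sideχ F θ.ν p (gOfRecord₁₃ F N θ.toStage13Params p) j))
    (S : ℕ → Set (Site (F.P p.K) 0)) (hS : S (j + 1) = ∅) :
    ∃ ŵ : (↥(Set.toFinite (bondsIn j ((s.init.Λ (j + 1))ᶜ ∩ s.init.Ω (j + 1)))).toFinset → FluctV N) → ℝ≥0∞, Measurable ŵ ∧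
      (∫⁻ a, ŵ a ∂(Measure.pi fun _ : ↥(Set.toFinite (bondsIn j ((s.init.Λ (j + 1))ᶜ ∩ s.init.Ω (j + 1)))).toFinset => (volume : Measure (FluctV N)))) ≠ ⊤ ∧
      ∀ ω, ENNReal.ofReal ((WtOfRecord₁₃H F N θ p s).w j (s.init.Λ (j + 1)) ((s.init.Λ (j + 1))ᶜ ∩ s.init.Ω (j + 1)) (S (j + 1)) ω) ≤
        ŵ (fun b : ↥(Set.toFinite (bondsIn j ((s.init.Λ (j + 1))ᶜ ∩ s.init.Ω (j + 1)))).toFinset => (ω j).2 b) :=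
  afibre_dominated_of_cover_of_quad_nonneg θ p s j hq (cover_of_mem_unionsOfCubes θ.ν p _ j hL hM₂ hsat) S hS

/-- **★★ THE ROW AT THE CERTIFICATE FOR THE ALL-SMALL BRANCH VALUE AT EVERY χ_{j+1}-SATURATED REGION** (`rePinH θ`, `quad ≡ 0`): the A-fibre domination row of
generation `j` at every history whose region `Λ_{j+1}(init s′)ᶜ ∩ Ω_{j+1}(init s′)` is a union of χ_{j+1}-cubes — print's `R_{j+1}`-type regions; the thin regions
of `…N11AFibreDominationRow` §3 are exactly the non-saturated ones with a free bond. [cite: Balaban1988Convergent, (2.21) p.258, (3.16) p.268, (3.21) p.269, (3.23) p.270] -/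
theorem afibre_dominated_rePinH_of_saturated (hL : 1 ≤ (F.P p.K).L) (hM₂ : 1 ≤ θ.ν.M₂) {k : ℕ}
    (s : SeqOfRecord F θ.ν θ.τ9.M (gOfRecord₁₃ F N θ.toStage13Params p) p.K (k + 1)) (j : ℕ)
    (hsat : (s.init.Λ (j + 1))ᶜ ∩ s.init.Ω (j + 1) ∈ unionsOfCubes (F.P p.K) (sideχ F θ.ν p (gOfRecord₁₃ F N θ.toStage13Params p) j))
    (S : ℕ → Set (Site (F.P p.K) 0)) (hS : S (j + 1) = ∅) :
    ∃ ŵ : (↥(Set.toFinite (bondsIn j ((s.init.Λ (j + 1))ᶜ ∩ s.init.Ω (j + 1)))).toFinset → FluctV N) → ℝ≥0∞, Measurable ŵ ∧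
      (∫⁻ a, ŵ a ∂(Measure.pi fun _ : ↥(Set.toFinite (bondsIn j ((s.init.Λ (j + 1))ᶜ ∩ s.init.Ω (j + 1)))).toFinset => (volume : Measure (FluctV N)))) ≠ ⊤ ∧
      ∀ ω, ENNReal.ofReal ((WtOfRecord₁₃H F N (rePinH θ) p s).w j (s.init.Λ (j + 1)) ((s.init.Λ (j + 1))ᶜ ∩ s.init.Ω (j + 1)) (S (j + 1)) ω) ≤
        ŵ (fun b : ↥(Set.toFinite (bondsIn j ((s.init.Λ (j + 1))ᶜ ∩ s.init.Ω (j + 1)))).toFinset => (ω j).2 b) :=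
  afibre_dominated_rePinH_of_cover θ p s j (cover_of_mem_unionsOfCubes θ.ν p _ j hL hM₂ hsat) S hS

end Row

/-! ## §3  ★★ What door (d3) gives at the certificate where the row IS discharged: the 𝐓-image clause at every no-large-field history from def-T's rows alone -/

section Clause

variable (θ : Stage13HParams F N) (p : B12.RunParams)

/-- **★★ THE NO-EXPANSION 𝐓-IMAGE CLAUSE AT THE CERTIFICATE AT EVERY NO-LARGE-FIELD HISTORY, FROM def-T's OPERAND ROWS ALONE**: dag-n11-d's witness-first ★★★
`exists_local_witness_clause_succ_rePinH_of_sLaw₁₃CoPH_of_dominated` with its (K0b) A-fibre domination rows DISCHARGED by `…N11AFibreDominationRow.rows_rePinH_of_noLargeField`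
at every no-expansion history `s′` with `Λ_i(s′) = Ω_i(s′)` (`1 ≤ i ≤ k`; ⊋ the all-large diagonal, where dag-n11-d's `rows_of_allLarge` discharges the operand rows as
well): from `SLaw₁₃CoPH (rePinH θ) p k` one k-local law-abiding witness `(t, E_k)` such that at every such `s′` the clause holds as soon as the old operand of THIS
witness is measurable and bounded on the multiscale configuration space (def-T's rows).  By `…N11AFibreDominationRow` §3 these are, at the certificate, essentially
the only histories door (d3) can reach on the all-small branch without [I]'s Gaussian value of `Zh.quad`.
[cite: Balaban1988Convergent, Theorem p.245, Thm 1 p.262, (3.24)–(3.25) p.270, (2.18) p.257, (2.21)–(2.23) p.258, (2.1) p.254] -/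
theorem exists_local_witness_clause_succ_rePinH_of_sLaw₁₃CoPH_of_noLargeField (h : θ.Provisos₁₃CoPH F N) {k : ℕ} (hk : k < p.K) (hM : 1 ≤ θ.τ9.M)
    (hS : SLaw₁₃CoPH F N (rePinH θ) p k) :
    ∃ (t : SeqOfRecord F θ.ν θ.τ9.M (gOfRecord₁₃ F N θ.toStage13Params p) p.K k → Sect2.TermValues (F.P p.K) (MatA N) (FluctV N) θ.τ9.M)
      (Ek : SeqOfRecord F θ.ν θ.τ9.M (gOfRecord₁₃ F N θ.toStage13Params p) p.K k → ℝ),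
      HasSect2FormAtZS F N (FluctV N) p.K (settingOfRecord₁₃ F N θ.toStage13Params p) k (θ.rzAt p) (WtOfRecord₁₃H F N (rePinH θ) p)
          (UbgOfRecord₁₃CoP F N θ.toStage13Params p k)
          (fun s₀ t₀ => Sect2.LawsRT (sect2TowerOfRecord F N (FluctV N) p.K (settingOfRecord₁₃ F N θ.toStage13Params p) (θ.rzAt p s₀) s₀ t₀)
            (settingOfRecord₁₃ F N θ.toStage13Params p).lf k)
          (slotsOfRecord F N θ.ν θ.τ9 (EOfRecord₁₃ F N θ.toStage13Params) (wOfRecord₉ F N θ.toStage9Params) θ.ppSel p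
            (gOfRecord₁₃ F N θ.toStage13Params p) k) t Ek ∧
      (∀ s₀, BalabanUVNodesN11FluctTruncationDefs.IsFluctLocal k (t s₀)) ∧
      ∀ (s : SeqOfRecord F θ.ν θ.τ9.M (gOfRecord₁₃ F N θ.toStage13Params p) p.K (k + 1)), s.Ω (k + 1) = ∅ →
        (∀ i, 1 ≤ i → i ≤ k → s.Λ i = s.Ω i) →
        (∀ S ∈ admSOfRecord F θ.ν θ.τ9.M (gOfRecord₁₃ F N θ.toStage13Params p) p.K k s.init,
          Measurable (fun ω : MultiCfg (F.P p.K) (SU N) (FluctV N) =>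
            sect2Operand F N (FluctV N) p.K (settingOfRecord₁₃ F N θ.toStage13Params p) (θ.rzAt p s.init) s.init (t s.init) (Ek s.init)
                (UbgOfRecord₁₃CoP F N θ.toStage13Params p k s.init) (S, fun j => (ω j).2) (fun j => (ω j).1)) ∧
          ∃ CΦ : ℝ, ∀ a U, sect2Operand F N (FluctV N) p.K (settingOfRecord₁₃ F N θ.toStage13Params p) (θ.rzAt p s.init) s.init (t s.init) (Ek s.init)
                (UbgOfRecord₁₃CoP F N θ.toStage13Params p k s.init) a U ≤ CΦ) →
        (slotsTOfRecord F N θ.ν θ.τ9 (EOfRecord₁₃ F N θ.toStage13Params) (wOfRecord₉ F N θ.toStage9Params) θ.ppSel p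
            (gOfRecord₁₃ F N θ.toStage13Params p) (k + 1) s = 0 ∨
          ∀ᵐ V' ∂fieldMeasure (F.P p.K) (k + 1) (SU N),
            chiSeqOfRecord F N θ.ν θ.τ9.M (gOfRecord₁₃ F N θ.toStage13Params p) p.K (k + 1) s V' ≠ 0 →
              slotsTOfRecord F N θ.ν θ.τ9 (EOfRecord₁₃ F N θ.toStage13Params) (wOfRecord₉ F N θ.toStage9Params) θ.ppSel p
                  (gOfRecord₁₃ F N θ.toStage13Params p) (k + 1) s V' =
                sect2Slot F N (FluctV N) p.K (settingOfRecord₁₃ F N θ.toStage13Params p) (θ.rzAt p s) (WtOfRecord₁₃H F N (rePinH θ) p s) s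
                  (t s.init) (Ek s.init) (UbgOfRecord₁₃CoP F N θ.toStage13Params p (k + 1) s) V') := by
  obtain ⟨t, Ek, hform, hloc, hstep⟩ :=
    BalabanUVNodesN11OldBranchIntegrableOfDominated.exists_local_witness_clause_succ_rePinH_of_sLaw₁₃CoPH_of_dominated θ p h hk hM hS
  exact ⟨t, Ek, hform, hloc, fun s hΩ hΛ hΦ => hstep s hΩ (fun S _ j => rows_rePinH_of_noLargeField θ p h s hΛ S j) hΦ⟩

end Clause

end Summit.QuantumFields.YangMills.Theorems.BalabanUVNodesN11AFibreDominationRowCubeCover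

end
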